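import Literature.MathematicalPhysics.QuantumFieldTheory.Balaban1983to89.T4CubeChartExp
import HarnessLib

/-!
# Crux `FluctuationComparisonRegPrIntL` (stmt-QuantumFields-20520, rung R3), PATH-B organ, v18 → v18.1 (H-currency): tool helper (W-MONO) —
# THE ANALYTICITY PREDICATE (β) `AnalyticPairWindowAt θ r B f` IS ANTITONE IN THE WINDOW `θ` AND IN THE RADIUS `r`

Cell `ym3-torus` (YM ladder rung R3 = continuum `SU(2)` Yang–Mills on the three-torus — a RUNG: NOT d = 4, NOT infinite volume, NOT a mass gap, NOT Clay).
Width seat `ym3-torus-px8` (gen 20); ★★OWNER RULING №70 (3) («TN-WINDOW-β», LEAD `ym-ust-20520-w3` g25 WORD №13): after the v18.1 text bump of block ⑧'s (β)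
window (`θBal∕2 ↦` a larger numeral) the BY-TEXT composition in `Lines/runpair_organ.lean` feeds S1aᴴ's (β) rows into ✓`…OrganTangentSeedHTriple.seedTriple_of_seed_of_analytic_three`'s
`hβ hβ'` at `PlaqSmall (θ ∕ 2)`, which needs a WINDOW-MONOTONICITY step; this file is that step, DEFINITION-FREE (the crux file's `AnalyticPairWindowAt` body —
`Cruxes/FluctuationComparisonRegPrIntL/V18DraftTexts.lean` v0.3 :59–66, = LEAD spec §1 — INLINED, exactly as in ✓p807878 `…OrganTangentGradientFromAnalytic`),
`--kind proof --supports stmt-QuantumFields-20520 --as helper`, count-neutral, default heartbeats, `autoImplicit false`; registry and `Lines/` untouched.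

WHAT THIS IS.  `AnalyticPairWindowAt θ r B f` says: at every `θ`-small base point `U`, every bond pair `(b, b′)` and unit directions `(v, v′)`, the two-parameter
family `(s, t) ↦ f (U moved by e^{s v} at b, then by e^{t v′} at b′)` is the real trace of a function `g` holomorphic on the bidisc of radius `r·θ` with oscillation
`‖g z − g 0‖ ≤ B` there.  Shrinking the window (`θ₂ ≤ θ₁`: fewer base points, `PlaqSmall` is monotone) and∕or the bidisc (`r₂·θ₂ ≤ r₁·θ₁`: `Metric.ball` inclusion,
`DifferentiableOn.mono`, the representation and oscillation rows restricted) preserves the predicate with the SAME `g` and the SAME bound `B`: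
* ★ `analyticPairWindowAt_mono` — the general form (`θ₂ ≤ θ₁`, `r₂·θ₂ ≤ r₁·θ₁`);
* `analyticPairWindowAt_window_mono` — the window alone (`0 ≤ r`, `θ₂ ≤ θ₁`; №70 (3)'s literal shape);
* `analyticPairWindowAt_radius_mono` — the radius alone (`0 ≤ θ`, `r₂ ≤ r₁`; S1aᴴ's docstring «analyticity at radius `rA` restricts to any smaller radius»);
* `analyticPairWindowAt_bound_mono` — the oscillation bound alone (`B₁ ≤ B₂`);
* `analyticPairWindowAt_window_mono_keep` — ideator g28 №3 (B)'s re-lift shape: window `θ₂ ≤ θ₁`, radius `r ↦ r·θ₁∕θ₂` (bidisc kept).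

HONEST FRAMING: set-inclusion bookkeeping over a HYPOTHESIS schema [folklore]; whether the runs' densities inhabit (β) on any window is print's claim
([Balaban1985UV3] p.263 (c) «analytic on the complexified small-field domain»), NOT formalised here; nothing of Bałaban's analysis is asserted or proved;
O1ᵘ-H v2∕v2.1, S1aᴴ, LINᵘ-H, the five registered stubs OPEN; crux 20520 `FluctuationComparisonRegPrIntL` ∕ `YM3TorusSU2` NOT proved; rung R3 = SU(2) YM₃ on T³ at
fixed lattice data — NOT d = 4, NOT infinite volume, NOT a mass gap, NOT Clay; the Yang–Mills mass gap is NOT proved.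
-/

set_option autoImplicit false

noncomputable section

namespace Summit.QuantumFields.YangMills.Theorems.OrganTangentAnalyticPairWindowMono

open Metric Set
open Literature.MathematicalPhysics.QuantumFieldTheory.Balaban1983to89
open T4CubeChartExp (expPt)

variable {P : Params} {j : ℕ}

/-- ★ **(β) IS ANTITONE IN (WINDOW, BIDISC)**: `AnalyticPairWindowAt θ₁ r₁ B f ⇒ AnalyticPairWindowAt θ₂ r₂ B f` whenever `θ₂ ≤ θ₁` and
`r₂·θ₂ ≤ r₁·θ₁` (texts INLINED; same holomorphic `g`, same bound `B`). [folklore] -/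
theorem analyticPairWindowAt_mono {θ₁ θ₂ r₁ r₂ B : ℝ} (hθ : θ₂ ≤ θ₁) (hrθ : r₂ * θ₂ ≤ r₁ * θ₁)
    (f : GaugeField P j ↥(Matrix.specialUnitaryGroup (Fin 2) ℂ) → ℝ)
    (hβ : ∀ (U : GaugeField P j ↥(Matrix.specialUnitaryGroup (Fin 2) ℂ)), PlaqSmall θ₁ U →
      ∀ (b b' : PBond P j) (v v' : Fin 3 → ℝ), ‖v‖ ≤ 1 → ‖v'‖ ≤ 1 →
        ∃ g : ℂ × ℂ → ℂ, DifferentiableOn ℂ g (Metric.ball (0 : ℂ) (r₁ * θ₁) ×ˢ Metric.ball (0 : ℂ) (r₁ * θ₁)) ∧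
          (∀ (s t : ℝ) (V Z : GaugeField P j ↥(Matrix.specialUnitaryGroup (Fin 2) ℂ)), |s| < r₁ * θ₁ → |t| < r₁ * θ₁ →
            (∀ e, e ≠ b → V e = U e) → V b = U b * expPt (s • v) → (∀ e, e ≠ b' → Z e = V e) → Z b' = V b' * expPt (t • v') →
            g ((s : ℂ), (t : ℂ)) = ((f Z : ℝ) : ℂ)) ∧
          ∀ z ∈ Metric.ball (0 : ℂ) (r₁ * θ₁) ×ˢ Metric.ball (0 : ℂ) (r₁ * θ₁), ‖g z - g 0‖ ≤ B) :
    ∀ (U : GaugeField P j ↥(Matrix.specialUnitaryGroup (Fin 2) ℂ)), PlaqSmall θ₂ U →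
      ∀ (b b' : PBond P j) (v v' : Fin 3 → ℝ), ‖v‖ ≤ 1 → ‖v'‖ ≤ 1 →
        ∃ g : ℂ × ℂ → ℂ, DifferentiableOn ℂ g (Metric.ball (0 : ℂ) (r₂ * θ₂) ×ˢ Metric.ball (0 : ℂ) (r₂ * θ₂)) ∧
          (∀ (s t : ℝ) (V Z : GaugeField P j ↥(Matrix.specialUnitaryGroup (Fin 2) ℂ)), |s| < r₂ * θ₂ → |t| < r₂ * θ₂ →
            (∀ e, e ≠ b → V e = U e) → V b = U b * expPt (s • v) → (∀ e, e ≠ b' → Z e = V e) → Z b' = V b' * expPt (t • v') →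
            g ((s : ℂ), (t : ℂ)) = ((f Z : ℝ) : ℂ)) ∧
          ∀ z ∈ Metric.ball (0 : ℂ) (r₂ * θ₂) ×ˢ Metric.ball (0 : ℂ) (r₂ * θ₂), ‖g z - g 0‖ ≤ B := by
  intro U hU b b' v v' hv hv'
  have hU₁ : PlaqSmall θ₁ U := fun p => (hU p).trans_le hθ
  obtain ⟨g, hg, hrep, hbd⟩ := hβ U hU₁ b b' v v' hv hv'
  have hball : Metric.ball (0 : ℂ) (r₂ * θ₂) ⊆ Metric.ball (0 : ℂ) (r₁ * θ₁) := Metric.ball_subset_ball hrθ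
  have hprod : Metric.ball (0 : ℂ) (r₂ * θ₂) ×ˢ Metric.ball (0 : ℂ) (r₂ * θ₂) ⊆
      Metric.ball (0 : ℂ) (r₁ * θ₁) ×ˢ Metric.ball (0 : ℂ) (r₁ * θ₁) := Set.prod_mono hball hball
  refine ⟨g, hg.mono hprod, ?_, fun z hz => hbd z (hprod hz)⟩
  intro s t V Z hs ht hVe hVb hZe hZb
  exact hrep s t V Z (hs.trans_le hrθ) (ht.trans_le hrθ) hVe hVb hZe hZb

/-- **(β) IS ANTITONE IN THE WINDOW** (★★OWNER RULING №70 (3)'s literal shape): `0 ≤ r`, `θ₂ ≤ θ₁`,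
`AnalyticPairWindowAt θ₁ r B f ⇒ AnalyticPairWindowAt θ₂ r B f`. [folklore] -/
theorem analyticPairWindowAt_window_mono {θ₁ θ₂ r B : ℝ} (hr : 0 ≤ r) (hθ : θ₂ ≤ θ₁)
    (f : GaugeField P j ↥(Matrix.specialUnitaryGroup (Fin 2) ℂ) → ℝ)
    (hβ : ∀ (U : GaugeField P j ↥(Matrix.specialUnitaryGroup (Fin 2) ℂ)), PlaqSmall θ₁ U →
      ∀ (b b' : PBond P j) (v v' : Fin 3 → ℝ), ‖v‖ ≤ 1 → ‖v'‖ ≤ 1 →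
        ∃ g : ℂ × ℂ → ℂ, DifferentiableOn ℂ g (Metric.ball (0 : ℂ) (r * θ₁) ×ˢ Metric.ball (0 : ℂ) (r * θ₁)) ∧
          (∀ (s t : ℝ) (V Z : GaugeField P j ↥(Matrix.specialUnitaryGroup (Fin 2) ℂ)), |s| < r * θ₁ → |t| < r * θ₁ →
            (∀ e, e ≠ b → V e = U e) → V b = U b * expPt (s • v) → (∀ e, e ≠ b' → Z e = V e) → Z b' = V b' * expPt (t • v') →
            g ((s : ℂ), (t : ℂ)) = ((f Z : ℝ) : ℂ)) ∧
          ∀ z ∈ Metric.ball (0 : ℂ) (r * θ₁) ×ˢ Metric.ball (0 : ℂ) (r * θ₁), ‖g z - g 0‖ ≤ B) :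
    ∀ (U : GaugeField P j ↥(Matrix.specialUnitaryGroup (Fin 2) ℂ)), PlaqSmall θ₂ U →
      ∀ (b b' : PBond P j) (v v' : Fin 3 → ℝ), ‖v‖ ≤ 1 → ‖v'‖ ≤ 1 →
        ∃ g : ℂ × ℂ → ℂ, DifferentiableOn ℂ g (Metric.ball (0 : ℂ) (r * θ₂) ×ˢ Metric.ball (0 : ℂ) (r * θ₂)) ∧
          (∀ (s t : ℝ) (V Z : GaugeField P j ↥(Matrix.specialUnitaryGroup (Fin 2) ℂ)), |s| < r * θ₂ → |t| < r * θ₂ →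
            (∀ e, e ≠ b → V e = U e) → V b = U b * expPt (s • v) → (∀ e, e ≠ b' → Z e = V e) → Z b' = V b' * expPt (t • v') →
            g ((s : ℂ), (t : ℂ)) = ((f Z : ℝ) : ℂ)) ∧
          ∀ z ∈ Metric.ball (0 : ℂ) (r * θ₂) ×ˢ Metric.ball (0 : ℂ) (r * θ₂), ‖g z - g 0‖ ≤ B :=
  analyticPairWindowAt_mono hθ (mul_le_mul_of_nonneg_left hθ hr) f hβ

/-- **(β) IS ANTITONE IN THE RADIUS** (S1aᴴ v0.3 docstring: «analyticity at radius `rA` restricts to any smaller radius»): `0 ≤ θ`, `r₂ ≤ r₁`,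
`AnalyticPairWindowAt θ r₁ B f ⇒ AnalyticPairWindowAt θ r₂ B f`. [folklore] -/
theorem analyticPairWindowAt_radius_mono {θ r₁ r₂ B : ℝ} (hθ : 0 ≤ θ) (hr : r₂ ≤ r₁)
    (f : GaugeField P j ↥(Matrix.specialUnitaryGroup (Fin 2) ℂ) → ℝ)
    (hβ : ∀ (U : GaugeField P j ↥(Matrix.specialUnitaryGroup (Fin 2) ℂ)), PlaqSmall θ U →
      ∀ (b b' : PBond P j) (v v' : Fin 3 → ℝ), ‖v‖ ≤ 1 → ‖v'‖ ≤ 1 →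
        ∃ g : ℂ × ℂ → ℂ, DifferentiableOn ℂ g (Metric.ball (0 : ℂ) (r₁ * θ) ×ˢ Metric.ball (0 : ℂ) (r₁ * θ)) ∧
          (∀ (s t : ℝ) (V Z : GaugeField P j ↥(Matrix.specialUnitaryGroup (Fin 2) ℂ)), |s| < r₁ * θ → |t| < r₁ * θ →
            (∀ e, e ≠ b → V e = U e) → V b = U b * expPt (s • v) → (∀ e, e ≠ b' → Z e = V e) → Z b' = V b' * expPt (t • v') →
            g ((s : ℂ), (t : ℂ)) = ((f Z : ℝ) : ℂ)) ∧
          ∀ z ∈ Metric.ball (0 : ℂ) (r₁ * θ) ×ˢ Metric.ball (0 : ℂ) (r₁ * θ), ‖g z - g 0‖ ≤ B) :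
    ∀ (U : GaugeField P j ↥(Matrix.specialUnitaryGroup (Fin 2) ℂ)), PlaqSmall θ U →
      ∀ (b b' : PBond P j) (v v' : Fin 3 → ℝ), ‖v‖ ≤ 1 → ‖v'‖ ≤ 1 →
        ∃ g : ℂ × ℂ → ℂ, DifferentiableOn ℂ g (Metric.ball (0 : ℂ) (r₂ * θ) ×ˢ Metric.ball (0 : ℂ) (r₂ * θ)) ∧
          (∀ (s t : ℝ) (V Z : GaugeField P j ↥(Matrix.specialUnitaryGroup (Fin 2) ℂ)), |s| < r₂ * θ → |t| < r₂ * θ →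
            (∀ e, e ≠ b → V e = U e) → V b = U b * expPt (s • v) → (∀ e, e ≠ b' → Z e = V e) → Z b' = V b' * expPt (t • v') →
            g ((s : ℂ), (t : ℂ)) = ((f Z : ℝ) : ℂ)) ∧
          ∀ z ∈ Metric.ball (0 : ℂ) (r₂ * θ) ×ˢ Metric.ball (0 : ℂ) (r₂ * θ), ‖g z - g 0‖ ≤ B :=
  analyticPairWindowAt_mono le_rfl (mul_le_mul_of_nonneg_right hr hθ) f hβ

/-- **(β) IS MONOTONE IN THE OSCILLATION BOUND**: `B₁ ≤ B₂`, `AnalyticPairWindowAt θ r B₁ f ⇒ AnalyticPairWindowAt θ r B₂ f` (for the `CB ↦ max CB 1`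
normalisation of S1aᴴ v0.3). [folklore] -/
theorem analyticPairWindowAt_bound_mono {θ r B₁ B₂ : ℝ} (hB : B₁ ≤ B₂)
    (f : GaugeField P j ↥(Matrix.specialUnitaryGroup (Fin 2) ℂ) → ℝ)
    (hβ : ∀ (U : GaugeField P j ↥(Matrix.specialUnitaryGroup (Fin 2) ℂ)), PlaqSmall θ U →
      ∀ (b b' : PBond P j) (v v' : Fin 3 → ℝ), ‖v‖ ≤ 1 → ‖v'‖ ≤ 1 →
        ∃ g : ℂ × ℂ → ℂ, DifferentiableOn ℂ g (Metric.ball (0 : ℂ) (r * θ) ×ˢ Metric.ball (0 : ℂ) (r * θ)) ∧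
          (∀ (s t : ℝ) (V Z : GaugeField P j ↥(Matrix.specialUnitaryGroup (Fin 2) ℂ)), |s| < r * θ → |t| < r * θ →
            (∀ e, e ≠ b → V e = U e) → V b = U b * expPt (s • v) → (∀ e, e ≠ b' → Z e = V e) → Z b' = V b' * expPt (t • v') →
            g ((s : ℂ), (t : ℂ)) = ((f Z : ℝ) : ℂ)) ∧
          ∀ z ∈ Metric.ball (0 : ℂ) (r * θ) ×ˢ Metric.ball (0 : ℂ) (r * θ), ‖g z - g 0‖ ≤ B₁) :
    ∀ (U : GaugeField P j ↥(Matrix.specialUnitaryGroup (Fin 2) ℂ)), PlaqSmall θ U →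
      ∀ (b b' : PBond P j) (v v' : Fin 3 → ℝ), ‖v‖ ≤ 1 → ‖v'‖ ≤ 1 →
        ∃ g : ℂ × ℂ → ℂ, DifferentiableOn ℂ g (Metric.ball (0 : ℂ) (r * θ) ×ˢ Metric.ball (0 : ℂ) (r * θ)) ∧
          (∀ (s t : ℝ) (V Z : GaugeField P j ↥(Matrix.specialUnitaryGroup (Fin 2) ℂ)), |s| < r * θ → |t| < r * θ →
            (∀ e, e ≠ b → V e = U e) → V b = U b * expPt (s • v) → (∀ e, e ≠ b' → Z e = V e) → Z b' = V b' * expPt (t • v') →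
            g ((s : ℂ), (t : ℂ)) = ((f Z : ℝ) : ℂ)) ∧
          ∀ z ∈ Metric.ball (0 : ℂ) (r * θ) ×ˢ Metric.ball (0 : ℂ) (r * θ), ‖g z - g 0‖ ≤ B₂ := by
  intro U hU b b' v v' hv hv'
  obtain ⟨g, hg, hrep, hbd⟩ := hβ U hU b b' v v' hv hv'
  exact ⟨g, hg, hrep, fun z hz => (hbd z hz).trans hB⟩

/-- **(β) WITH THE BIDISC KEPT** (ideator g28 №3 (B)'s re-lift shape): `θ₂ ≤ θ₁`, `0 < θ₂`,
`AnalyticPairWindowAt θ₁ r B f ⇒ AnalyticPairWindowAt θ₂ (r·θ₁∕θ₂) B f` — the base window shrinks, the bidisc radius `(r·θ₁∕θ₂)·θ₂ = r·θ₁` is kept,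
so a (β) row on the bumped window `θβ·θBal` restricts to the old window `θBal∕2` with radius `≥ rA` and the v18 docks re-close by `exact`. [folklore] -/
theorem analyticPairWindowAt_window_mono_keep {θ₁ θ₂ r B : ℝ} (hθ : θ₂ ≤ θ₁) (hθ₂ : 0 < θ₂)
    (f : GaugeField P j ↥(Matrix.specialUnitaryGroup (Fin 2) ℂ) → ℝ)
    (hβ : ∀ (U : GaugeField P j ↥(Matrix.specialUnitaryGroup (Fin 2) ℂ)), PlaqSmall θ₁ U →
      ∀ (b b' : PBond P j) (v v' : Fin 3 → ℝ), ‖v‖ ≤ 1 → ‖v'‖ ≤ 1 →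
        ∃ g : ℂ × ℂ → ℂ, DifferentiableOn ℂ g (Metric.ball (0 : ℂ) (r * θ₁) ×ˢ Metric.ball (0 : ℂ) (r * θ₁)) ∧
          (∀ (s t : ℝ) (V Z : GaugeField P j ↥(Matrix.specialUnitaryGroup (Fin 2) ℂ)), |s| < r * θ₁ → |t| < r * θ₁ →
            (∀ e, e ≠ b → V e = U e) → V b = U b * expPt (s • v) → (∀ e, e ≠ b' → Z e = V e) → Z b' = V b' * expPt (t • v') →
            g ((s : ℂ), (t : ℂ)) = ((f Z : ℝ) : ℂ)) ∧
          ∀ z ∈ Metric.ball (0 : ℂ) (r * θ₁) ×ˢ Metric.ball (0 : ℂ) (r * θ₁), ‖g z - g 0‖ ≤ B) :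
    ∀ (U : GaugeField P j ↥(Matrix.specialUnitaryGroup (Fin 2) ℂ)), PlaqSmall θ₂ U →
      ∀ (b b' : PBond P j) (v v' : Fin 3 → ℝ), ‖v‖ ≤ 1 → ‖v'‖ ≤ 1 →
        ∃ g : ℂ × ℂ → ℂ, DifferentiableOn ℂ g (Metric.ball (0 : ℂ) (r * θ₁ / θ₂ * θ₂) ×ˢ Metric.ball (0 : ℂ) (r * θ₁ / θ₂ * θ₂)) ∧
          (∀ (s t : ℝ) (V Z : GaugeField P j ↥(Matrix.specialUnitaryGroup (Fin 2) ℂ)), |s| < r * θ₁ / θ₂ * θ₂ → |t| < r * θ₁ / θ₂ * θ₂ →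
            (∀ e, e ≠ b → V e = U e) → V b = U b * expPt (s • v) → (∀ e, e ≠ b' → Z e = V e) → Z b' = V b' * expPt (t • v') →
            g ((s : ℂ), (t : ℂ)) = ((f Z : ℝ) : ℂ)) ∧
          ∀ z ∈ Metric.ball (0 : ℂ) (r * θ₁ / θ₂ * θ₂) ×ˢ Metric.ball (0 : ℂ) (r * θ₁ / θ₂ * θ₂), ‖g z - g 0‖ ≤ B :=
  analyticPairWindowAt_mono hθ (le_of_eq (div_mul_cancel₀ (r * θ₁) hθ₂.ne')) f hβ

end Summit.QuantumFields.YangMills.Theorems.OrganTangentAnalyticPairWindowMono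

end
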